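import Literature.Computability.Complexity.SparseSetsUpwardSeparation
import Literature.Computability.Complexity.CodeFPArith
import Literature.Computability.Complexity.NPBoundedQuantifiers
import Literature.Computability.Complexity.KarpLipton
import Literature.Computability.Complexity.KannanLanguage
import HarnessLib

/-!
# Sparse sets in `NP − P`, I: the census tally set of a sparse `NP` set is in `NP`
(Hartmanis–Immerman–Sewelson 1985, toward Corollary 4)

Topic `Literature/Computability/Complexity`. First of three files proving the named fact
`hartmanisImmermanSewelson1985_cor4` of `SparseSetsUpwardSeparation.lean` (Information and Control
65 (1985), Cor. 4, p. 166: "there exist sparse sets in `NP − P` iff there exist tally sets in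
`NP − P`"). The printed proof is Theorem 1 (p. 163: sparse `S ∈ NP − P ⟺ EXPTIME ≠ NEXPTIME`, by
the census encoding `S' = {n#i#j#k#d | …}` of pp. 163–164) followed by Book's tally translation;
neither is a theorem of the tree. We formalize the SAME census encoding directly at the
polynomial level, with a tally set in place of the `NEXPTIME` set `S'` (the exponential padding of
`S'` and its tally translation compose to the identity on lengths, so nothing is lost): for a
language `S` the **census tally set** `tallyOf S ⊆ 0*` contains `0^m`, `m = ⟨t, n, i, r, k⟩`
(iterated Cantor pairing `Nat.pair`, `pair5`/`decode5`), iff there is a chain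
`x₀ <ᵥ x₁ <ᵥ ⋯ <ᵥ x_{i-1}` of words of length `n` in `S` (strictly increasing binary values
`bitsToNat`, `IsChain`) and either `t = 0` (a census query "`|S ∩ Σⁿ| ≥ i`", p. 164) or `t = 1`
and the `k`-th bit of `x_r` is `1` (a naming query, p. 163: "`i` and `j` encode … the position in
`S` of `x` and … `k` and `d` encode the characters that make up `x`").

Main results of this file:

* `SparseTally.tallyOf`, `SparseTally.isTally_tallyOf`, `SparseTally.replicate_mem_tallyOf_iff`;
* **`SparseTally.tallyOf_mem_NP`**: `S ∈ NP ⇒ tallyOf S ∈ NP` (p. 164, items 2–3: "we need to guess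
  only a polynomial in `n` number of strings of length `n` … verification of membership in `S` is a
  nondeterministic polynomial-in-`n` process"). The witness is the concatenation of the chain; the
  proof uses only closure properties of `NP` already in the tree (`∃ᵖ·NP ⊆ NP`,
  `KarpLipton.polyExists_polyExists_subset`; bounded `∀`, `NPBounded.ballLang_mem_NP`;
  `preimage_mem_NP`; meets/joins with `P` languages) and ONE polynomial-time predicate assembled in
  the typed toolkit `CodeFP` (decoding `m`, cutting the witness into blocks `CodeFP.strChunks`,
  the consecutive comparisons, the bit test);
* the `CodeFP` computations `natPairC`, `natUnpairC`, `pair5C`, `decode5C` reused by the census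
  decider of `SparseSetsUpwardSeparationCensus.lean`.

No named fact and no definition of mathematical content is introduced (D-0026): everything in
namespace `SparseTally` is a proof device of the discharge of `hartmanisImmermanSewelson1985_cor4`.

## References

* J. Hartmanis, N. Immerman, V. Sewelson, *Sparse sets in NP−P: EXPTIME versus NEXPTIME*,
  Information and Control 65 (1985) 158–181: Theorem 1 and its proof (pp. 163–164), Corollary 4
  (p. 166) (held: `paper:doi-10-1016-s0019-9958-85-80004-8`, p0006–p0009).
  [HartmanisImmermanSewelson1985]
* S. Arora, B. Barak, *Computational Complexity: A Modern Approach*, CUP 2009, Def. 2.1, §1.3.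
-/

noncomputable section

namespace Literature.Computability.Complexity

open _root_.Computability Polynomial CodeFP Nondeterministic
open Literature.Barriers.PneNP (IsSparseLanguage IsTally)

namespace SparseTally

/-- The type of names `(t, n, i, r, k)`. [folklore] -/
abbrev Name : Type := ℕ × ℕ × ℕ × ℕ × ℕ

/-- The numeric code of a name, by iterated Cantor pairing (`Nat.pair`). [cite: HartmanisImmermanSewelson1985, proof of Theorem 1 (p. 163)] -/
def pair5 (q : Name) : ℕ :=
  Nat.pair q.1 (Nat.pair q.2.1 (Nat.pair q.2.2.1 (Nat.pair q.2.2.2.1 q.2.2.2.2)))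

/-- The name coded by a number (total: `Nat.unpair` is a bijection). [cite: HartmanisImmermanSewelson1985, proof of Theorem 1 (p. 163)] -/
def decode5 (m : ℕ) : Name :=
  ((Nat.unpair m).1, (Nat.unpair (Nat.unpair m).2).1, (Nat.unpair (Nat.unpair (Nat.unpair m).2).2).1,
    (Nat.unpair (Nat.unpair (Nat.unpair (Nat.unpair m).2).2).2).1,
    (Nat.unpair (Nat.unpair (Nat.unpair (Nat.unpair m).2).2).2).2)

/-- Decoding inverts coding. [folklore] -/
@[simp] theorem decode5_pair5 (q : Name) : decode5 (pair5 q) = q := by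
  obtain ⟨t, n, i, r, k⟩ := q
  simp [decode5, pair5]

/-- The component `t` of a name is at most its code. (Proofs about `decode5` go through `unfold`:
definitional unfolding of `Nat.unpair` on a variable is expensive for the elaborator.) [folklore] -/
theorem decode5_t_le (m : ℕ) : (decode5 m).1 ≤ m := by
  unfold decode5
  exact Nat.unpair_left_le m

/-- The component `n` of a name is at most its code. [folklore] -/
theorem decode5_n_le (m : ℕ) : (decode5 m).2.1 ≤ m := by
  have h1 : ∀ x : ℕ, (Nat.unpair x).1 ≤ x := Nat.unpair_left_le
  have h2 : ∀ x : ℕ, (Nat.unpair x).2 ≤ x := Nat.unpair_right_le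
  unfold decode5
  exact (h1 _).trans (h2 _)

/-- The component `i` of a name is at most its code. [folklore] -/
theorem decode5_i_le (m : ℕ) : (decode5 m).2.2.1 ≤ m := by
  have h1 : ∀ x : ℕ, (Nat.unpair x).1 ≤ x := Nat.unpair_left_le
  have h2 : ∀ x : ℕ, (Nat.unpair x).2 ≤ x := Nat.unpair_right_le
  unfold decode5
  exact ((h1 _).trans (h2 _)).trans (h2 _)

/-- The component `r` of a name is at most its code. [folklore] -/
theorem decode5_r_le (m : ℕ) : (decode5 m).2.2.2.1 ≤ m := by
  have h1 : ∀ x : ℕ, (Nat.unpair x).1 ≤ x := Nat.unpair_left_le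
  have h2 : ∀ x : ℕ, (Nat.unpair x).2 ≤ x := Nat.unpair_right_le
  unfold decode5
  exact ((h1 _).trans (h2 _)).trans ((h2 _).trans (h2 _))

/-- The component `k` of a name is at most its code. [folklore] -/
theorem decode5_k_le (m : ℕ) : (decode5 m).2.2.2.2 ≤ m := by
  have h2 : ∀ x : ℕ, (Nat.unpair x).2 ≤ x := Nat.unpair_right_le
  unfold decode5
  exact ((h2 _).trans (h2 _)).trans ((h2 _).trans (h2 _))

/-! ### B. Blocks, chains, the tally set -/

/-- The `i` consecutive blocks of length `n` of a string. [folklore] -/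
def chunks (n i : ℕ) (y : List Bool) : List (List Bool) :=
  (List.range i).map fun j => (y.drop (j * n)).take n

/-- There are `i` blocks. [folklore] -/
@[simp] theorem length_chunks (n i : ℕ) (y : List Bool) : (chunks n i y).length = i := by
  simp [chunks]

/-- The `j`-th block. [folklore] -/
theorem getD_chunks {n i j : ℕ} (y : List Bool) (hj : j < i) :
    (chunks n i y).getD j [] = (y.drop (j * n)).take n := by
  rw [List.getD_eq_getElem _ _ (by simpa using hj)]
  simp [chunks]

/-- Membership in the list of blocks. [folklore] -/
theorem mem_chunks_iff {n i : ℕ} {y z : List Bool} :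
    z ∈ chunks n i y ↔ ∃ j < i, (y.drop (j * n)).take n = z := by
  simp [chunks]

/-- Blocks of a string of length `i n` have length `n`. [folklore] -/
theorem length_of_mem_chunks {n i : ℕ} {y z : List Bool} (hy : y.length = i * n)
    (hz : z ∈ chunks n i y) : z.length = n := by
  obtain ⟨j, hj, rfl⟩ := mem_chunks_iff.1 hz
  rw [List.length_take, List.length_drop, hy]
  have : n ≤ i * n - j * n := by
    rw [← Nat.sub_mul]
    exact Nat.le_mul_of_pos_left n (by omega)
  omega

/-- Cutting the concatenation of blocks of length `n` gives the blocks back. [folklore] -/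
theorem chunks_flatten {n : ℕ} : ∀ {l : List (List Bool)}, (∀ z ∈ l, z.length = n) →
    chunks n l.length l.flatten = l
  | [], _ => by simp [chunks]
  | z :: l, h => by
    have hz : z.length = n := h z (by simp)
    have ih := chunks_flatten (l := l) fun x hx => h x (by simp [hx])
    simp only [chunks, List.length_cons, List.flatten_cons] at ih ⊢
    rw [List.range_succ_eq_map, List.map_cons, List.map_map]
    congr 1
    · rw [Nat.zero_mul, List.drop_zero, ← hz, List.take_left]
    · conv_rhs => rw [← ih]
      refine List.map_congr_left fun j _ => ?_
      simp only [Function.comp_apply]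
      rw [List.drop_append, List.drop_eq_nil_of_le (by rw [hz]; nlinarith), List.nil_append, hz]
      congr 2
      rw [Nat.succ_mul]
      omega

/-- The strict value order of bit strings (least significant bit first). [folklore] -/
def ltV (a b : List Bool) : Prop := bitsToNat a < bitsToNat b

/-- The consecutive comparisons of a list of blocks, as computed by the verifier. [folklore] -/
def sortedB (l : List (List Bool)) : Bool :=
  (List.zipWith (fun a b => decide (bitsToNat a < bitsToNat b)) l l.tail).all fun b => b

/-- The consecutive comparisons hold iff the list is a chain for the value order (the order is
transitive). [folklore] -/
theorem sortedB_eq_true_iff : ∀ l : List (List Bool), sortedB l = true ↔ l.Pairwise ltV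
  | [] => by simp [sortedB]
  | [a] => by simp [sortedB]
  | a :: b :: l => by
    have ih := sortedB_eq_true_iff (b :: l)
    simp only [sortedB, List.tail_cons, List.zipWith_cons_cons, List.all_cons, Bool.and_eq_true,
      decide_eq_true_eq] at ih ⊢
    rw [ih, List.pairwise_cons (a := a) (l := b :: l)]
    constructor
    · rintro ⟨hab, hbl⟩
      refine ⟨fun x hx => ?_, hbl⟩
      rcases List.mem_cons.1 hx with rfl | hx
      · exact hab
      · exact lt_trans hab ((List.pairwise_cons.1 hbl).1 x hx)
    · rintro ⟨hal, hbl⟩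
      exact ⟨hal b (by simp), hbl⟩

/-- The bit test as computed by the verifier: the block of length `1` at position `k`. [folklore] -/
def bitB (z : List Bool) (k : ℕ) : Bool := decide ((z.drop k).take 1 = [true])

/-- The bit test reads the `k`-th bit (default `0`). [folklore] -/
theorem bitB_eq_getD (z : List Bool) (k : ℕ) : bitB z k = z.getD k false := by
  unfold bitB
  rw [List.getD_eq_getElem?_getD]
  by_cases hk : k < z.length
  · rw [List.drop_eq_getElem_cons hk, List.take_succ_cons, List.take_zero, List.getElem?_eq_getElem hk]
    cases z[k] <;> simp
  · push Not at hk
    rw [List.drop_eq_nil_of_le hk, List.take_nil, List.getElem?_eq_none hk]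
    simp

/-- **Chains**: lists of words of length `n` in `S`, strictly increasing in value. [cite: HartmanisImmermanSewelson1985, proof of Theorem 1 (p. 163: "x₁ < x₂ < ⋯ < xᵢ")] -/
def IsChain (S : Language Bool) (n : ℕ) (l : List (List Bool)) : Prop :=
  (∀ z ∈ l, z.length = n ∧ z ∈ S) ∧ l.Pairwise ltV

/-- **The meaning of a name** `(t, n, i, r, k)`: some chain of length `i` in `S ∩ Σⁿ` exists, and
if `t = 1` the `k`-th bit of its `r`-th word is `1` (`t = 0`: a census query; `t = 1`: a naming
query; other `t`: false). [cite: HartmanisImmermanSewelson1985, proof of Theorem 1 (pp. 163–164)] -/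
def NameOK (S : Language Bool) (q : Name) : Prop :=
  ∃ l : List (List Bool), l.length = q.2.2.1 ∧ IsChain S q.2.1 l ∧
    (q.1 = 0 ∨ (q.1 = 1 ∧ (l.getD q.2.2.2.1 []).getD q.2.2.2.2 false = true))

/-- **The census tally set of `S`**: the words `0^m` whose length names a true statement.
[cite: HartmanisImmermanSewelson1985, proof of Theorem 1 (pp. 163–164) and Corollary 4 (p. 166)] -/
def tallyOf (S : Language Bool) : Language Bool :=
  {w | (∀ b ∈ w, b = false) ∧ NameOK S (decode5 w.length)}

/-- The census tally set is tally. [folklore] -/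
theorem isTally_tallyOf (S : Language Bool) : IsTally (tallyOf S) := fun _ hw => hw.1

/-- Membership of a query word `0^{⟨q⟩}`. [folklore] -/
theorem replicate_mem_tallyOf_iff (S : Language Bool) (q : Name) :
    List.replicate (pair5 q) false ∈ tallyOf S ↔ NameOK S q := by
  change (∀ b ∈ List.replicate (pair5 q) false, b = false) ∧ NameOK S (decode5 (List.replicate _ _).length) ↔ _
  rw [List.length_replicate, decode5_pair5]
  exact ⟨fun h => h.2, fun h => ⟨fun b hb => List.eq_of_mem_replicate hb, h⟩⟩

/-! ### C. The verifier's predicates (mathematical form) -/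

/-- The polynomial-time part of the verifier on `(w, y)`: with `(t, n, i, r, k)` the name of `|w|`,
the witness has length `i n`, its blocks increase in value, and the query condition on `t`. [cite: HartmanisImmermanSewelson1985, proof of Theorem 1 (p. 164, items 1–3)] -/
def verifP (p : List Bool × List Bool) : Bool :=
  decide (p.2.length = (decode5 p.1.length).2.2.1 * (decode5 p.1.length).2.1) &&
    (sortedB (chunks (decode5 p.1.length).2.1 (decode5 p.1.length).2.2.1 p.2) &&
      (decide ((decode5 p.1.length).1 = 0) ||
        (decide ((decode5 p.1.length).1 = 1) &&
          bitB ((chunks (decode5 p.1.length).2.1 (decode5 p.1.length).2.2.1 p.2).getD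
            (decode5 p.1.length).2.2.2.1 []) (decode5 p.1.length).2.2.2.2)))

/-- The `j`-th block of the witness (the word whose membership in `S` is the `j`-th `NP` conjunct). [folklore] -/
def blockAt (v : (List Bool × List Bool) × ℕ) : List Bool :=
  (v.1.2.drop (v.2 * (decode5 v.1.1.length).2.1)).take (decode5 v.1.1.length).2.1

/-- The index test `i ≤ j` switching off the conjuncts past the chain. [folklore] -/
def idxGe (v : (List Bool × List Bool) × ℕ) : Bool := decide ((decode5 v.1.1.length).2.2.1 ≤ v.2)

/-- **The meaning of a name, witness form**: `NameOK S q` iff some string `y` of length `i n`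
passes the polynomial-time test and all its blocks are in `S`. [cite: HartmanisImmermanSewelson1985, proof of Theorem 1 (p. 164, items 1–3)] -/
theorem nameOK_iff (S : Language Bool) (w : List Bool) :
    NameOK S (decode5 w.length) ↔ ∃ y : List Bool, verifP (w, y) = true ∧
      ∀ j < (decode5 w.length).2.2.1, blockAt ((w, y), j) ∈ S := by
  set q := decode5 w.length with hq
  constructor
  · rintro ⟨l, hlen, ⟨hmem, hsort⟩, hcond⟩
    have hfl : chunks q.2.1 q.2.2.1 l.flatten = l := by
      rw [← hlen]; exact chunks_flatten fun z hz => (hmem z hz).1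
    refine ⟨l.flatten, ?_, fun j hj => ?_⟩
    · simp only [verifP, Bool.and_eq_true, decide_eq_true_eq, Bool.or_eq_true]
      refine ⟨?_, ?_, ?_⟩
      · rw [List.length_flatten, ← hlen]
        have : l.map List.length = l.map (fun _ => q.2.1) :=
          List.map_congr_left fun z hz => (hmem z hz).1
        rw [this, List.map_const', List.sum_replicate, smul_eq_mul]
      · rw [hfl, sortedB_eq_true_iff]; exact hsort
      · rw [hfl, bitB_eq_getD]; exact hcond
    · change (l.flatten.drop (j * q.2.1)).take q.2.1 ∈ S
      rw [← getD_chunks l.flatten hj, hfl, List.getD_eq_getElem _ _ (by omega)]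
      exact (hmem _ (List.getElem_mem _)).2
  · rintro ⟨y, hv, hS⟩
    simp only [verifP, Bool.and_eq_true, decide_eq_true_eq, Bool.or_eq_true] at hv
    obtain ⟨hlen, hsort, hcond⟩ := hv
    refine ⟨chunks q.2.1 q.2.2.1 y, length_chunks _ _ _, ⟨fun z hz => ⟨length_of_mem_chunks hlen hz, ?_⟩,
      (sortedB_eq_true_iff _).1 hsort⟩, by rwa [bitB_eq_getD] at hcond⟩
    obtain ⟨j, hj, rfl⟩ := mem_chunks_iff.1 hz
    exact hS j hj


/-! ### D. The verifier's predicates are polynomial time (typed toolkit `CodeFP`) -/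

/-- Code of names: nested pairs of binary numerals. [folklore] -/
abbrev nameE : Name → List Bool := pairE natE (pairE natE (pairE natE (pairE natE natE)))

/-- **Cantor pairing is polynomial time** on binary numerals. [folklore] -/
theorem natPairC : CodeFP (pairE natE natE) natE (fun p => Nat.pair p.1 p.2) := by
  have ha : CodeFP (pairE natE natE) natE (fun p => p.1) := fst _ _
  have hb : CodeFP (pairE natE natE) natE (fun p => p.2) := snd _ _
  have h := (natLt.comp (ha.pair hb)).ite (natAdd.comp ((natMul.comp (hb.pair hb)).pair ha))
    (natAdd.comp ((natAdd.comp ((natMul.comp (ha.pair ha)).pair ha)).pair hb))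
  refine h.congr fun p => ?_
  by_cases hlt : p.1 < p.2 <;> simp [Nat.pair, hlt]

/-- **Cantor unpairing is polynomial time** (integer square root `CodeFP.natSqrt`). [folklore] -/
theorem natUnpairC : CodeFP natE (pairE natE natE) Nat.unpair := by
  have hs : CodeFP natE natE Nat.sqrt := natSqrt
  have hd : CodeFP natE natE (fun n => n - Nat.sqrt n * Nat.sqrt n) :=
    natSub.comp ((CodeFP.id natE).pair (natMul.comp (hs.pair hs)))
  have h := (natLt.comp (hd.pair hs)).ite (hd.pair hs) (hs.pair (natSub.comp (hd.pair hs)))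
  refine h.congr fun n => ?_
  rw [Nat.unpair]
  by_cases hlt : n - Nat.sqrt n * Nat.sqrt n < Nat.sqrt n <;> simp [hlt]

/-- Coding a name is polynomial time. [folklore] -/
theorem pair5C : CodeFP nameE natE pair5 := by
  have h4 : CodeFP nameE natE (fun q => Nat.pair q.2.2.2.1 q.2.2.2.2) :=
    (natPairC.comp (snd natE _).snd'.snd').congr fun _ => rfl
  have h3 : CodeFP nameE natE (fun q => Nat.pair q.2.2.1 (Nat.pair q.2.2.2.1 q.2.2.2.2)) :=
    natPairC.comp ((snd natE _).snd'.fst'.pair h4)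
  have h2 : CodeFP nameE natE (fun q => Nat.pair q.2.1 (Nat.pair q.2.2.1 (Nat.pair q.2.2.2.1 q.2.2.2.2))) :=
    natPairC.comp ((snd natE _).fst'.pair h3)
  exact (natPairC.comp ((fst natE _).pair h2)).congr fun _ => rfl

/-- Decoding a name is polynomial time. [folklore] -/
theorem decode5C : CodeFP natE nameE decode5 := by
  have ha : CodeFP natE (pairE natE natE) Nat.unpair := natUnpairC
  have hb : CodeFP natE (pairE natE natE) (fun m => Nat.unpair (Nat.unpair m).2) := natUnpairC.comp ha.snd'
  have hc : CodeFP natE (pairE natE natE) (fun m => Nat.unpair (Nat.unpair (Nat.unpair m).2).2) :=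
    natUnpairC.comp hb.snd'
  have hd : CodeFP natE (pairE natE natE)
      (fun m => Nat.unpair (Nat.unpair (Nat.unpair (Nat.unpair m).2).2).2) := natUnpairC.comp hc.snd'
  refine (ha.fst'.pair (hb.fst'.pair (hc.fst'.pair (hd.fst'.pair hd.snd')))).congr fun m => ?_
  unfold decode5
  rfl

/-- The consecutive comparisons are polynomial time. [folklore] -/
theorem sortedBC : CodeFP (rawE strE) bitE sortedB := by
  have hcmp : CodeFP (pairE unitE (pairE strE strE)) bitE
      (fun t => decide (bitsToNat t.2.1 < bitsToNat t.2.2)) :=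
    natLt.comp ((strVal.comp (snd _ _).fst').pair (strVal.comp (snd _ _).snd'))
  have hz := zipWith hcmp
  have hall : CodeFP (pairE unitE (rawE bitE)) bitE (fun q => q.2.all fun b => b) :=
    (all (snd unitE bitE)).congr fun _ => rfl
  exact (hall.comp ((const _ ()).pair (hz.comp ((const _ ()).pair ((CodeFP.id _).pair
    (rawTail strE)))))).congr fun _ => rfl

/-- Cutting into blocks is polynomial time (`CodeFP.strChunks`, counts in unary). [folklore] -/
theorem chunksC : CodeFP (pairE unE (pairE unE strE)) (rawE strE) (fun p => chunks p.2.1 p.1 p.2.2) :=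
  strChunks.congr fun _ => rfl

/-- The bit test is polynomial time (position in unary). [folklore] -/
theorem bitBC : CodeFP (pairE strE unE) bitE (fun p => bitB p.1 p.2) :=
  ((CodeFP.eq (eα := strE) (fun _ _ h => h)).comp ((strTake.comp ((const _ 1).pair
    (strDrop.comp ((snd strE unE).pair (fst strE unE))))).pair (const _ [true]))).congr fun _ => rfl

/-- **The polynomial-time part of the verifier is polynomial time.** [cite: HartmanisImmermanSewelson1985, proof of Theorem 1 (p. 164)] -/
theorem verifPC : CodeFP (pairE strE strE) bitE verifP := by
  have hq : CodeFP (pairE strE strE) nameE (fun p => decode5 p.1.length) :=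
    decode5C.comp (strNatLength.comp (fst _ _))
  have ht : CodeFP (pairE strE strE) natE (fun p => (decode5 p.1.length).1) := hq.fst'
  have hn : CodeFP (pairE strE strE) natE (fun p => (decode5 p.1.length).2.1) := hq.snd'.fst'
  have hi : CodeFP (pairE strE strE) natE (fun p => (decode5 p.1.length).2.2.1) := hq.snd'.snd'.fst'
  have hr : CodeFP (pairE strE strE) natE (fun p => (decode5 p.1.length).2.2.2.1) :=
    hq.snd'.snd'.snd'.fst'
  have hk : CodeFP (pairE strE strE) natE (fun p => (decode5 p.1.length).2.2.2.2) :=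
    hq.snd'.snd'.snd'.snd'
  have hU : CodeFP (pairE strE strE) unE (fun p => p.1.length) := strLength.comp (fst _ _)
  have hnU : CodeFP (pairE strE strE) unE (fun p => (decode5 p.1.length).2.1) :=
    (unOfNatMin.comp (hU.pair hn)).congr fun p => by
      dsimp only
      exact min_eq_left (decode5_n_le p.1.length)
  have hiU : CodeFP (pairE strE strE) unE (fun p => (decode5 p.1.length).2.2.1) :=
    (unOfNatMin.comp (hU.pair hi)).congr fun p => by
      dsimp only
      exact min_eq_left (decode5_i_le p.1.length)
  have hkU : CodeFP (pairE strE strE) unE (fun p => (decode5 p.1.length).2.2.2.2) :=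
    (unOfNatMin.comp (hU.pair hk)).congr fun p => by
      dsimp only
      exact min_eq_left (decode5_k_le p.1.length)
  have hch : CodeFP (pairE strE strE) (rawE strE)
      (fun p => chunks (decode5 p.1.length).2.1 (decode5 p.1.length).2.2.1 p.2) :=
    (chunksC.comp (hiU.pair (hnU.pair (snd _ _)))).congr fun _ => by dsimp only
  have hlen : CodeFP (pairE strE strE) bitE
      (fun p => decide (p.2.length = (decode5 p.1.length).2.2.1 * (decode5 p.1.length).2.1)) :=
    natEq.comp ((strNatLength.comp (snd _ _)).pair (natMul.comp (hi.pair hn)))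
  have hsort := sortedBC.comp hch
  have hrow : CodeFP (pairE strE strE) strE
      (fun p => (chunks (decode5 p.1.length).2.1 (decode5 p.1.length).2.2.1 p.2).getD
        (decode5 p.1.length).2.2.2.1 []) :=
    ((rawGetD strE (d := []) rfl).comp (hch.pair hr)).congr fun _ => by dsimp only
  have hbit := bitBC.comp (hrow.pair hkU)
  have ht0 : CodeFP (pairE strE strE) bitE (fun p => decide ((decode5 p.1.length).1 = 0)) :=
    natEq.comp (ht.pair (const _ 0))
  have ht1 : CodeFP (pairE strE strE) bitE (fun p => decide ((decode5 p.1.length).1 = 1)) :=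
    natEq.comp (ht.pair (const _ 1))
  exact (hlen.and (hsort.and (ht0.or (ht1.and hbit)))).congr fun _ => by dsimp only [verifP]

/-- The index test is polynomial time. [folklore] -/
theorem idxGeC : CodeFP (pairE (pairE strE strE) unE) bitE idxGe := by
  have hi : CodeFP (pairE (pairE strE strE) unE) natE (fun v => (decode5 v.1.1.length).2.2.1) :=
    (decode5C.comp (strNatLength.comp (fst _ _).fst')).snd'.snd'.fst'
  exact (natLe.comp (hi.pair (natOfUn.comp (snd _ _)))).congr fun _ => rfl

/-- Extracting the `j`-th block is polynomial time. [folklore] -/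
theorem blockAtC : CodeFP (pairE (pairE strE strE) unE) strE blockAt := by
  have hn : CodeFP (pairE (pairE strE strE) unE) natE (fun v => (decode5 v.1.1.length).2.1) :=
    (decode5C.comp (strNatLength.comp (fst _ _).fst')).snd'.fst'
  have hnU : CodeFP (pairE (pairE strE strE) unE) unE (fun v => (decode5 v.1.1.length).2.1) :=
    (unOfNatMin.comp ((strLength.comp (fst _ _).fst').pair hn)).congr fun v => by
      dsimp only
      exact min_eq_left (decode5_n_le v.1.1.length)
  have hy : CodeFP (pairE (pairE strE strE) unE) strE (fun v => v.1.2) := (fst _ _).snd'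
  have hcnt : CodeFP (pairE (pairE strE strE) unE) unE
      (fun v => min (v.2 * (decode5 v.1.1.length).2.1) v.1.2.length) :=
    unOfNatMin.comp ((strLength.comp hy).pair (natMul.comp ((natOfUn.comp (snd _ _)).pair hn)))
  refine (strTake.comp (hnU.pair (strDrop.comp (hcnt.pair hy)))).congr fun v => ?_
  simp only [blockAt]
  congr 1
  by_cases h : v.2 * (decode5 v.1.1.length).2.1 ≤ v.1.2.length
  · rw [min_eq_left h]
  · push Not at h
    rw [min_eq_right h.le, List.drop_length, List.drop_eq_nil_of_le h.le]


/-! ### E. The census tally set of an `NP` set is in `NP` -/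

/-- The one-word language `{[1]}` (target of the one-bit predicates) is in `P`. [folklore] -/
theorem singletonTrue_mem_P : ({v | v = [true]} : Language Bool) ∈ Classes.P := by
  have h := setOf_apply_eq_apply_mem_P (f := id) (g := fun _ => [true]) (PolyTimeComputable.id _)
    (const_mem_FP [true])
  exact h

/-- The tally words `0*` form a language in `P` (fixed points of `Kannan.zerosFn`). [folklore] -/
theorem zeros_mem_P : ({w | ∀ b ∈ w, b = false} : Language Bool) ∈ Classes.P := by
  have h := setOf_apply_eq_apply_mem_P (f := Kannan.zerosFn) (g := id) Kannan.zerosFn_mem_FP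
    (PolyTimeComputable.id _)
  have he : ({z | Kannan.zerosFn z = id z} : Language Bool) = {w | ∀ b ∈ w, b = false} := by
    ext w
    change Kannan.zerosFn w = w ↔ ∀ b ∈ w, b = false
    rw [Kannan.zerosFn_apply, eq_comm, List.eq_replicate_iff]
    exact ⟨fun h => h.2, fun h => ⟨rfl, h⟩⟩
  rwa [he] at h

/-- The witness of a name of `m` is short: `i n ≤ m²`. [folklore] -/
theorem verifP_length_le {w y : List Bool} (h : verifP (w, y) = true) :
    y.length ≤ w.length * w.length := by
  simp only [verifP, Bool.and_eq_true, decide_eq_true_eq] at h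
  rw [h.1]
  exact Nat.mul_le_mul (decode5_i_le _) (decode5_n_le _)

/-- **The census tally set of an `NP` language is in `NP`** (Hartmanis–Immerman–Sewelson: "given a
five-tuple … we need to guess only a polynomial in `n` number of strings of length `n` … verification
of membership in `S` is a nondeterministic polynomial-in-`n` process", so `S' ∈ NEXPTIME`; at the
tally scale `|0^m| = m ≥ n` this is `NP`). Witness: the concatenated chain `y`; matrix: the `P`
predicate `verifP` and, for every `j < i`, the `NP` condition "block `j` of `y` is in `S`"
(`NPBounded.ballLang_mem_NP`, `preimage_mem_NP`); the two existential blocks merge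
(`KarpLipton.polyExists_polyExists_subset`). [cite: HartmanisImmermanSewelson1985, proof of Theorem 1 (p. 164, items 1–3)] -/
theorem tallyOf_mem_NP {S : Language Bool} (hS : S ∈ NP) : tallyOf S ∈ NP := by
  obtain ⟨Fp, hFp, hFps⟩ := verifPC
  obtain ⟨Fi, hFi, hFis⟩ := idxGeC
  obtain ⟨Fb, hFb, hFbs⟩ := blockAtC
  -- the matrix `A = AP ⊓ ∀ⱼ (idx ≥ i ∨ block j ∈ S)`
  have hAP : (Fp ⁻¹' {v | v = [true]} : Language Bool) ∈ Classes.P := preimage_mem_P singletonTrue_mem_P hFp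
  have hA' : ((Fi ⁻¹' {v | v = [true]}) ⊔ (Fb ⁻¹' S) : Language Bool) ∈ NP :=
    union_P_mem_polyExists (fun _ _ h₁ h₂ => union_mem_P h₁ h₂) (preimage_mem_P singletonTrue_mem_P hFi)
      (preimage_mem_NP hS hFb)
  have hA : ((Fp ⁻¹' {v | v = [true]}) ⊓ ballLang X ((Fi ⁻¹' {v | v = [true]}) ⊔ (Fb ⁻¹' S)) :
      Language Bool) ∈ NP :=
    inter_P_mem_polyExists (fun _ _ h₁ h₂ => inter_mem_P h₁ h₂) hAP (NPBounded.ballLang_mem_NP X hA')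
  -- membership in the matrix, on pairs
  have hmemP : ∀ w y : List Bool, boolPair w y ∈ (Fp ⁻¹' {v | v = [true]} : Language Bool) ↔
      verifP (w, y) = true := fun w y => by
    change Fp (boolPair w y) = [true] ↔ _
    rw [show boolPair w y = pairE strE strE (w, y) from rfl, hFps]
    simp [bitE]
  have hmemB : ∀ w y : List Bool,
      boolPair w y ∈ ballLang X ((Fi ⁻¹' {v | v = [true]}) ⊔ (Fb ⁻¹' S)) ↔
        ∀ j < (decode5 w.length).2.2.1, blockAt ((w, y), j) ∈ S := fun w y => by
    rw [mem_ballLang, eval_X, length_boolPair]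
    have hv : ∀ j : ℕ, boolPair (boolPair w y) (List.replicate j true) =
        pairE (pairE strE strE) unE ((w, y), j) := fun j => by
      simp [pairE, unE_eq_ones, ones]
    have hmem' : ∀ j : ℕ, boolPair (boolPair w y) (List.replicate j true) ∈
        ((Fi ⁻¹' {v | v = [true]}) ⊔ (Fb ⁻¹' S) : Language Bool) ↔
          (decode5 w.length).2.2.1 ≤ j ∨ blockAt ((w, y), j) ∈ S := fun j => by
      change Fi _ = [true] ∨ Fb _ ∈ S ↔ _
      rw [hv, hFis, hFbs]
      simp [bitE, idxGe]
    simp only [hmem']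
    have hi : (decode5 w.length).2.2.1 ≤ w.length := decode5_i_le _
    constructor
    · intro h j hj
      exact (h j (by omega)).resolve_left (by omega)
    · intro h j _
      by_cases hij : (decode5 w.length).2.2.1 ≤ j
      · exact Or.inl hij
      · exact Or.inr (h j (by omega))
  -- the core language, two existential blocks merged
  have hcore : ({w | NameOK S (decode5 w.length)} : Language Bool) ∈ NP := by
    refine KarpLipton.polyExists_polyExists_subset (K := Classes.P)
      (fun _ hL _ hg => preimage_mem_P hL hg) (fun _ _ h₁ h₂ => inter_mem_P h₁ h₂) ⟨_, hA, X * X, fun w => ?_⟩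
    change NameOK S (decode5 w.length) ↔ _
    rw [nameOK_iff]
    constructor
    · rintro ⟨y, hv, hb⟩
      refine ⟨y, ?_, (hmemP w y).2 hv, (hmemB w y).2 hb⟩
      simpa using verifP_length_le hv
    · rintro ⟨y, -, hv, hb⟩
      exact ⟨y, (hmemP w y).1 hv, (hmemB w y).1 hb⟩
  have heq : tallyOf S = ({w | ∀ b ∈ w, b = false} : Language Bool) ⊓ {w | NameOK S (decode5 w.length)} :=
    rfl
  rw [heq]
  exact inter_P_mem_polyExists (fun _ _ h₁ h₂ => inter_mem_P h₁ h₂) zeros_mem_P hcore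

end SparseTally

end Literature.Computability.Complexity
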